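import Mathlib

/-! # `Balaban1983to89.B9SectCCubes` — B9 Sect. C, pp. 408/411/412/413/415: the SUP-NORM CUBE CALCULUS of the
localization cubes (□, □̃ⁿ, □₀ = □̃², «a sum of 5^d cubes», X̃⁵, «□̃₀² = □̃⁴») kernel-checked

CITATION HEADER (lean-in-tree rule 2026-08-18).  Paper sub-cell `b2b-balaban-b09` (gen 9, journal claim
`B9-SECTC-CUBES`, cell pub-balaban) on T. Bałaban, *Propagators for lattice gauge theories in a background field*,
Commun. Math. Phys. **99** (1985) 389–434 [`Balaban1985BackgroundPropagators`] (= B9; journal page = PDF page + 388),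
pp. 408, 411, 412, 413, 415 [PDF 20, 23, 24, 25, 27] (renders `b2b-balaban-ref1/pages/1985-cmp99-background-propagators/
…-p020-x2.png`, `…-p023-x2.png`, `…-p024-x2.png`, `…-p025-x2.png`, `…-p027-x2.png`, READ AS IMAGES by this unit), with
[4] = *Propagators for lattice gauge theories II*, Commun. Math. Phys. **96** (1984) 223–250 [`Balaban1984PropagatorsII`]
(= B6) p. 229 [PDF 7] (render `…/1984-cmp96-propagators-rt-II/…-p007-x2.png`, read as an image).  Sibling of
`…Balaban1983to89.B9` (whose `p408_domains_fit`, cell C-B9-10, is the collar arithmetic «Ω₀(□) ⊂ □̃⁵» of p. 408 —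
NOT restated here); imports Mathlib only; nothing landed is edited.

WHAT IS PRINTED (verbatim).
* B6 p. 229: *"Each set Λ_j is a sum of big blocks of the size ML^jη (Λ_j ⊂ T^{(j)}_{L^jη}), or of the size M if Λ_j is
  scaled to unit lattice. We cover B^j(Λ_j) by a sum of cubes □ of the size 2ML^jη, each cube being a sum of 2^d big
  blocks with a center y ∈ Λ_j (more exactly it belongs to the boundary of this set also). Taking these covers for all
  j from 0 to k we get a family 𝒟 of cubes □ of different sizes and such that T_η = ⋃_{□∈𝒟} □. We will identify this
  family of cubes with the set of centers of these cubes."*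
* B9 p. 408: *"Each set B^j(Λ_j) is a union of big blocks, which are elementary cubes (cells) of the lattice ML^jηZ^d
  (or rather the lattice T^{(j+m)}_{ML^jη}, if M = L^m). We take a family 𝒟_j of cubes □, with centers at points of
  this lattice, which are unions of 2^d big blocks, with at least one of them contained in B^j(Λ_j)."* … *"For a cube
  □ ∈ 𝒟 and n = 1, 2,… we define □̃ⁿ as a cube of the size (2 + 2n)ML^jη, and with the same center as □, hence it
  is a union of (2 + 2n)^d big blocks."*
* B9 p. 411: *"If □̃ does not intersect any cube of the family 𝒟_{j+1}, then we define 𝒟′ replacing in 𝒟 the cube □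
  by □̃², and removing all the cubes intersecting □̃. If □̃ intersects a cube from 𝒟_{j+1}, then we take a cube □₁
  from 𝒟_{j+1} which is closest to the center of □, we replace □ by □̃₁², and we remove all the cubes which
  intersect □̃₁. Let us denote by □₀ the cube □̃² in the first case, and □̃₁² in the second."*
* B9 p. 412: *"We have to notice only that the operators may differ outside □̃₀, and the distance from □̃ to □̃₀ᶜ is
  at least M (on L^{−j}-scale)."*
* B9 p. 413: *"We consider only very small families, containing several cubes. A biggest is connected with operators
  localized in □₀, which is a sum of 5^d cubes from 𝒟."* … *"An operator R(X) has the following important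
  properties: it is localized in X, i.e. its kernel has a support in X × X, it depends on U restricted to X̃⁵, and
  satisfies a bound of the type (3.89)"*; Theorem 3.9: *"A term in this expansion corresponding to a walk ω depends
  on U restructed* [sic] *to X̃₀⁵ ∪ X̃₁⁵ ∪ … ∪ X̃ₙ⁵"* (Theorem 3.10, p. 416: *"depends on configuration U
  restricted to X̃₀⁵ ∪ X̃₁⁵ ∪ … ∪ X̃ₙ⁵"*).
* B9 p. 415: *"For the cube □₀ we construct a new partition 𝒟″ replacing □₀ by □̃₀² and removing from 𝒟′ all the
  cubes which intersect □̃₀. We take the operator G′_{□̃₀²} with the boundary conditions outside □̃₀⁵. In terms of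
  the original cubes □, or □₁, we have □̃₀² = □̃⁴, or □̃₀² = □̃₁⁴, and the boundary conditions are outside □̃⁸, or
  □̃₁⁸."*

THE MODEL (lengths in units L^jη; the continuum envelope of the lattice in sup-norm coordinates, as in the cell's
`…TreeLength` / `…B13WalkCubes111`).  A point is `x : Fin d → ℝ`; `box c r` is the closed coordinate box of
half-width `r` about `c`; a cube □ ∈ 𝒟_j with centre `c` is `box c M` (size 2M = 2^d big blocks), and
`tilde c M n` = □̃ⁿ = `box c ((n+1)M)` (size (2+2n)M, same centre; `tilde c M 0 = box c M` = □).  By B6 p. 229 /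
B9 p. 408 the centres of 𝒟_j run over the points of the M-lattice (a COVER by overlapping cubes — B9 p. 408's
later words *"The family 𝒟 is a partition of the lattice T"* notwithstanding; only the cover reading is compatible
with the smooth partition of unity Σ h_□² = 1 of [4] (2.36) and with p. 413's count 5^d, see `box0_eq`); the cubes
of 𝒟_j meeting the interior of □̃ are those with centres `shift c M k = c + Mk`, `k ∈ shifts d` = {−2,…,2}^d.

WHAT THIS FILE CERTIFIES (kernel, zero sorry, Mathlib only; every item [folklore] arithmetic — no estimate, operator
or configuration of B9 occurs).
1. `biUnion_shift_box` — THE KEY IDENTITY: for 0 < M ≤ r, ⋃_{k ∈ {−2,…,2}^d} box (c + Mk) r = box c (r + 2M)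
   (⊇ by the clamped floor `kOf`; ⊆ by the triangle inequality); `card_shifts`: |{−2,…,2}^d| = 5^d;
   `shift_box_meets_interior_iff`: the cubes of 𝒟_j (centres c + Mk, k ∈ ℤ^d) meeting the interior of □̃ are
   exactly these 5^d (p. 411's *"removing all the cubes intersecting □̃"*).
2. `box0_eq` — p. 413 *"□₀, which is a sum of 5^d cubes from 𝒟"* with p. 411 *"□₀ the cube □̃²"*: the 5^d cubes
   box (c + Mk) M, |k|_∞ ≤ 2, fill `tilde c M 2` = □̃² EXACTLY (this is also p. 411's 𝒟′: removing them and
   inserting □̃² keeps a cover).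
3. `tilde_box0_eq` — tildes of the DOMAIN □₀ taken cube-by-cube: ⋃_{|k|_∞≤2} (c + Mk)~ⁿ = □̃^{n+2}; instances
   `p415_tilde0_two` (n = 2: □̃₀² = □̃⁴ — print p. 415 ✓) and `p415_tilde0_five` (n = 5: □̃₀⁵ = □̃⁷; print p. 415
   writes *"outside □̃⁸"*: since □̃⁷ ⊆ □̃⁸ (`tilde_mono`) the printed cube is a correct, one-block-larger enclosure —
   the cell's print-level note GAPS G-adv4-5 (4) «□̃₀⁵ = □̃⁷ by the size rule», now with a kernel anchor).
4. `X5box0_eq`, `depSet_subset_X5` — the set X̃⁵ of p. 413 / Thm 3.9 / Thm 3.10 for the localization domain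
   X = □₀, read as the union of the constituents' □̃′⁵: X̃⁵(□₀) = □̃⁷ ⊇ □̃⁵ ∪ □̃⁷ (the U-dependence set
   Ω₀(□) ∪ Ω₀(□₀) ⊂ □̃⁵ ∪ □̃₀⁵ of the domain-change factors under the cell's reading R-□₀; XREAD C-b09g9-1 §3.2).
5. `case2_subset` — second case of p. 411 (□₀ = □̃₁², □₁ ∈ 𝒟_{j+1} with big blocks ML and centre c₁,
   |c − c₁|_∞ ≤ (L+1)M): □̃⁵ ⊆ □̃₁⁷, i.e. 6M + (L+1)M ≤ 8ML ⟸ L ≥ 1.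
6. `tilde_diam`, `X5box0_diam` — sup-diameters: □̃ⁿ has coordinate extent 2(n+1)M, so X̃⁵(□₀) = □̃⁷ has extent
   16M = 16 big blocks under B9's size rule (a numerical anchor for the thickness parameter τ that `…B13WalkCubes111`
   records as unprinted and illustrates with a 15-block; that module's theorems are parametric in τ and B13's own
   cube conventions, [`Balaban1988RG2Cluster`] p. 3, are not examined here — nothing there is contradicted).
7. `dist_tilde_compl` — p. 412 *"the distance from □̃ to □̃₀ᶜ is at least M"*: with □̃₀ = □̃³ (item 3, n = 1) every
   point within sup-distance M of □̃ = `tilde c M 1` lies in `tilde c M 3` (indeed within 2M: the printed "at least M"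
   is not tight).  Case 1 only; case 2 is item 8.
8. §5 (v1.1, the three LOW remarks R1–R3 of the cross-read certificate `b2b-balaban-adv1/XREAD-B9SectCCubes.md`,
   cell C-A37-1, typed — no statement of v1 changes): `case2_subset_closed` (R1: item 5's offset (L+1)M is the
   interior-intersection reading (iii) for integer L — `lattice_offset_le`: an offset that is an integer multiple of
   M and is < (L+2)M is ≤ (L+1)M; with the CLOSED-intersection offset (L+2)M the inclusion □̃⁵ ⊆ □̃₁⁷ still holds for
   L ≥ 2, 6M + (L+2)M ≤ 8LM ⟸ 8 ≤ 7L); `dist_tilde_compl_case2` (R2: p. 412's distance clause in case 2, □̃₀ = □̃₁³: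
   every point within 2M of □̃ lies in □̃₁³ when |c − c₁|_∞ ≤ (L+1)M and L ≥ 2, 5M + LM ≤ 4LM; FALSE for L = 1 —
   irrelevant, L ≥ 2 throughout the series); `finer_meeting_subset_box0` (R3: near ∂B^j(Λ_j) a removed cube may belong
   to 𝒟_{j−1}, half-width M/L; if its box meets the interior of □̃ it lies inside □̃² = □₀ for L ≥ 2,
   2·M/L + 2M ≤ 3M — so 𝒟′ stays a cover; the COUNT 5^d of item 2 is claimed only away from such boundaries).
SCOPE (candid).  Pure coordinate-box arithmetic over ℝ^d; the lattice, the sets B^j(Λ_j), the membership condition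
*"at least one of them contained in B^j(Λ_j)"*, the collars of {Ω_n(□)} (`B9.p408_domains_fit`) and everything about
operators are NOT modelled.  Value = kernel-checked bookkeeping certificate for print-level readings used by the
cell's records (G-adv4-5 (4), C-adv4-20 (j), r1 `SectC-diff-proof.md` (G′)(4), XREAD C-b09g9-1), NOT summit progress.
Cell records: GAPS C-B9-49 (this module, v1), C-B9-52 (v1.1), C-A37-1 (cross-read), G-adv4-5 (4). -/

namespace Literature.MathematicalPhysics.QuantumFieldTheory.Balaban1983to89.B9SectCCubes

variable {d : ℕ}

/-! ## §1  Coordinate boxes and the cubes □̃ⁿ -/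

/-- The closed sup-norm box of half-width `r` about `c` (lengths in units L^jη). [folklore] -/
def box (c : Fin d → ℝ) (r : ℝ) : Set (Fin d → ℝ) := {x | ∀ i, |x i - c i| ≤ r}

/-- Membership in a box, coordinatewise. [folklore] -/
theorem mem_box {c : Fin d → ℝ} {r : ℝ} {x : Fin d → ℝ} : x ∈ box c r ↔ ∀ i, |x i - c i| ≤ r := Iff.rfl

/-- Boxes grow with the half-width. [folklore] -/
theorem box_mono (c : Fin d → ℝ) {r r' : ℝ} (h : r ≤ r') : box c r ⊆ box c r' :=
  fun _ hx i => (hx i).trans h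

/-- Re-centring: `box c r ⊆ box c' r'` as soon as `|c i − c' i| + r ≤ r'` in every coordinate. [folklore] -/
theorem box_subset_box {c c' : Fin d → ℝ} {r r' : ℝ} (h : ∀ i, |c i - c' i| + r ≤ r') :
    box c r ⊆ box c' r' := by
  intro x hx i
  have h1 : |x i - c' i| ≤ |x i - c i| + |c i - c' i| := abs_sub_le (x i) (c i) (c' i)
  linarith [hx i, h i]

/-- □̃ⁿ for the cube □ = `box c M` ∈ 𝒟_j: *"a cube of the size (2 + 2n)ML^jη, and with the same center as □"*
(p. 408) — half-width (n+1)M; `n = 0` is □ itself, `n = 1` is □̃. [cite: Balaban1985BackgroundPropagators, p.408] -/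
def tilde (c : Fin d → ℝ) (M : ℝ) (n : ℕ) : Set (Fin d → ℝ) := box c (((n : ℝ) + 1) * M)

/-- Unfolding □̃ⁿ. [folklore] -/
theorem tilde_def (c : Fin d → ℝ) (M : ℝ) (n : ℕ) : tilde c M n = box c (((n : ℝ) + 1) * M) := rfl

/-- □̃⁰ = □ (size 2M). [folklore] -/
theorem tilde_zero (c : Fin d → ℝ) (M : ℝ) : tilde c M 0 = box c M := by
  rw [tilde_def]; congr 1; push_cast; ring

/-- □̃ = □̃¹ has half-width 2M (size 4M = "(2 + 2)M"). [folklore] -/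
theorem tilde_one (c : Fin d → ℝ) (M : ℝ) : tilde c M 1 = box c (2 * M) := by
  rw [tilde_def]; congr 1; push_cast; ring

/-- □̃ⁿ ⊆ □̃ᵐ for n ≤ m (M ≥ 0). [folklore] -/
theorem tilde_mono (c : Fin d → ℝ) {M : ℝ} (hM : 0 ≤ M) {n m : ℕ} (h : n ≤ m) : tilde c M n ⊆ tilde c M m := by
  refine box_mono c (mul_le_mul_of_nonneg_right ?_ hM)
  have : (n : ℝ) ≤ m := by exact_mod_cast h
  linarith

/-- Coordinate extent of □̃ⁿ: any two of its points differ by at most 2(n+1)M in each coordinate. [folklore] -/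
theorem tilde_diam {c : Fin d → ℝ} {M : ℝ} {n : ℕ} {x y : Fin d → ℝ} (hx : x ∈ tilde c M n)
    (hy : y ∈ tilde c M n) (i : Fin d) : |x i - y i| ≤ 2 * (((n : ℝ) + 1) * M) := by
  have h := abs_sub_le (x i) (c i) (y i)
  have hy' : |c i - y i| ≤ ((n : ℝ) + 1) * M := by rw [abs_sub_comm]; exact hy i
  linarith [hx i]

/-! ## §2  The 5^d cubes of 𝒟_j around □ and the key union identity -/

/-- The shifts k ∈ {−2, …, 2}^d: the cubes of 𝒟_j meeting the interior of □̃ have centres c + Mk. [folklore] -/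
noncomputable def shifts (d : ℕ) : Finset (Fin d → ℤ) := Fintype.piFinset fun _ => Finset.Icc (-2 : ℤ) 2

/-- Membership in the shift set, coordinatewise. [folklore] -/
theorem mem_shifts {k : Fin d → ℤ} : k ∈ shifts d ↔ ∀ i, -2 ≤ k i ∧ k i ≤ 2 := by
  simp [shifts, Fintype.mem_piFinset, Finset.mem_Icc]

/-- There are 5^d of them (p. 413: *"a sum of 5^d cubes from 𝒟"*). [folklore] -/
theorem card_shifts (d : ℕ) : (shifts d).card = 5 ^ d := by
  rw [shifts, Fintype.card_piFinset]
  simp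

/-- The centre c + Mk of the shifted cube. [folklore] -/
def shift (c : Fin d → ℝ) (M : ℝ) (k : Fin d → ℤ) : Fin d → ℝ := fun i => c i + M * (k i : ℝ)

/-- Coordinates of the shifted centre. [folklore] -/
theorem shift_apply (c : Fin d → ℝ) (M : ℝ) (k : Fin d → ℤ) (i : Fin d) :
    shift c M k i = c i + M * (k i : ℝ) := rfl

/-- Which cubes of 𝒟_j (centres on the M-lattice through c, half-width M) meet the INTERIOR of □̃ = `box c (2M)`:
exactly the 5^d with shift k ∈ {−2,…,2}^d (p. 411 *"removing all the cubes intersecting □̃"*, p. 413 *"5^d cubes"*).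
[folklore] -/
theorem shift_box_meets_interior_iff {c : Fin d → ℝ} {M : ℝ} (hM : 0 < M) (k : Fin d → ℤ) :
    (∃ x ∈ box (shift c M k) M, ∀ i, |x i - c i| < 2 * M) ↔ k ∈ shifts d := by
  rw [mem_shifts]
  constructor
  · rintro ⟨x, hx, hlt⟩ i
    have h1 := hx i
    rw [shift_apply] at h1
    obtain ⟨h1a, h1b⟩ := abs_le.mp h1
    obtain ⟨h2a, h2b⟩ := abs_lt.mp (hlt i)
    have hk3 : (k i : ℝ) < 3 := by
      by_contra hcon
      have hcon := not_lt.mp hcon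
      have : 3 * M ≤ M * (k i : ℝ) := by nlinarith
      linarith
    have hk3' : -3 < (k i : ℝ) := by
      by_contra hcon
      have hcon := not_lt.mp hcon
      have : M * (k i : ℝ) ≤ -(3 * M) := by nlinarith
      linarith
    have a : k i < 3 := by exact_mod_cast hk3
    have b : -3 < k i := by exact_mod_cast hk3'
    exact ⟨by omega, by omega⟩
  · intro hk
    refine ⟨fun i => c i + 2 / 3 * (M * (k i : ℝ)), fun i => ?_, fun i => ?_⟩
    · have hk1 : (-2 : ℝ) ≤ k i := by exact_mod_cast (hk i).1
      have hk2 : (k i : ℝ) ≤ 2 := by exact_mod_cast (hk i).2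
      have hMk1 : -(2 * M) ≤ M * (k i : ℝ) := by nlinarith
      have hMk2 : M * (k i : ℝ) ≤ 2 * M := by nlinarith
      show |c i + 2 / 3 * (M * (k i : ℝ)) - shift c M k i| ≤ M
      rw [shift_apply, abs_le]
      constructor <;> linarith
    · have hk1 : (-2 : ℝ) ≤ k i := by exact_mod_cast (hk i).1
      have hk2 : (k i : ℝ) ≤ 2 := by exact_mod_cast (hk i).2
      have hMk1 : -(2 * M) ≤ M * (k i : ℝ) := by nlinarith
      have hMk2 : M * (k i : ℝ) ≤ 2 * M := by nlinarith
      show |c i + 2 / 3 * (M * (k i : ℝ)) - c i| < 2 * M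
      rw [abs_lt]
      constructor <;> linarith

/-- The clamped floor: the shift in {−2,…,2} whose cube of half-width r ≥ M catches a coordinate t with
|t| ≤ r + 2M. [folklore] -/
noncomputable def kOf (M t : ℝ) : ℤ := max (-2) (min 2 ⌊t / M⌋)

/-- The clamped floor lies in {−2,…,2}. [folklore] -/
theorem kOf_bounds (M t : ℝ) : -2 ≤ kOf M t ∧ kOf M t ≤ 2 :=
  ⟨le_max_left _ _, max_le (by norm_num) (min_le_left _ _)⟩

/-- The one-dimensional covering step behind `biUnion_shift_box`. [folklore] -/
theorem abs_sub_kOf_le {M r t : ℝ} (hM : 0 < M) (hr : M ≤ r) (ht : |t| ≤ r + 2 * M) :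
    |t - M * (kOf M t : ℝ)| ≤ r := by
  have hfl : ((⌊t / M⌋ : ℤ) : ℝ) ≤ t / M := Int.floor_le _
  have hlt : t / M < ((⌊t / M⌋ : ℤ) : ℝ) + 1 := Int.lt_floor_add_one _
  obtain ⟨ht1, ht2⟩ := abs_le.mp ht
  set q : ℤ := ⌊t / M⌋ with hq
  rcases le_or_gt 3 q with h3 | h3
  · -- ⌊t/M⌋ ≥ 3 : the shift is clamped to 2
    have hk : kOf M t = 2 := by
      unfold kOf; rw [← hq, min_eq_left (by omega : (2 : ℤ) ≤ q)]; norm_num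
    have h3' : (3 : ℝ) ≤ q := by exact_mod_cast h3
    have ht3 : 3 * M ≤ t := (le_div_iff₀ hM).mp (h3'.trans hfl)
    rw [hk]; push_cast
    rw [abs_of_nonneg (by linarith)]
    linarith
  · rcases lt_or_ge q (-2) with h2 | h2
    · -- ⌊t/M⌋ ≤ −3 : the shift is clamped to −2
      have hk : kOf M t = -2 := by
        unfold kOf; rw [← hq, min_eq_right (by omega : q ≤ 2)]; exact max_eq_left (by omega)
      have hq' : (q : ℝ) + 1 ≤ -2 := by
        have : q + 1 ≤ -2 := by omega
        exact_mod_cast this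
      have htl : t < -2 * M := (div_lt_iff₀ hM).mp (hlt.trans_le hq')
      rw [hk]; push_cast
      rw [abs_of_neg (by linarith)]
      linarith
    · -- −2 ≤ ⌊t/M⌋ ≤ 2 : the shift is ⌊t/M⌋ itself
      have hk : kOf M t = q := by
        unfold kOf; rw [← hq, min_eq_right (by omega : q ≤ 2)]; exact max_eq_right h2
      have h0 : (q : ℝ) * M ≤ t := (le_div_iff₀ hM).mp hfl
      have h1 : t < ((q : ℝ) + 1) * M := (div_lt_iff₀ hM).mp hlt
      have h1' : t < (q : ℝ) * M + M := by linarith [h1, show ((q : ℝ) + 1) * M = (q : ℝ) * M + M by ring]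
      rw [hk, abs_of_nonneg (by linarith)]
      linarith

/-- **KEY IDENTITY.** For 0 < M ≤ r the 5^d boxes of half-width r centred at c + Mk, |k|_∞ ≤ 2, fill exactly the
box of half-width r + 2M about c. [folklore] -/
theorem mem_biUnion_shift_box_iff {c : Fin d → ℝ} {M r : ℝ} (hM : 0 < M) (hr : M ≤ r) (x : Fin d → ℝ) :
    (x ∈ ⋃ k ∈ shifts d, box (shift c M k) r) ↔ x ∈ box c (r + 2 * M) := by
  simp only [Set.mem_iUnion, mem_box, shift_apply, exists_prop]
  constructor
  · rintro ⟨k, hk, hx⟩ i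
    have hki := (mem_shifts.mp hk) i
    have habs : |(k i : ℝ)| ≤ 2 :=
      abs_le.mpr ⟨by exact_mod_cast hki.1, by exact_mod_cast hki.2⟩
    have h2 : |M * (k i : ℝ)| ≤ 2 * M := by
      rw [abs_mul, abs_of_pos hM]; nlinarith
    have e : x i - c i = (x i - (c i + M * (k i : ℝ))) + M * (k i : ℝ) := by ring
    rw [e]
    exact (abs_add_le _ _).trans (by linarith [hx i])
  · intro hx
    refine ⟨fun i => kOf M (x i - c i), mem_shifts.mpr fun i => kOf_bounds _ _, fun i => ?_⟩
    have e : x i - (c i + M * (kOf M (x i - c i) : ℝ)) = (x i - c i) - M * (kOf M (x i - c i) : ℝ) := by ring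
    rw [e]
    exact abs_sub_kOf_le hM hr (hx i)

/-- Set form of `mem_biUnion_shift_box_iff`. [folklore] -/
theorem biUnion_shift_box {c : Fin d → ℝ} {M r : ℝ} (hM : 0 < M) (hr : M ≤ r) :
    (⋃ k ∈ shifts d, box (shift c M k) r) = box c (r + 2 * M) :=
  Set.ext (mem_biUnion_shift_box_iff hM hr)

/-! ## §3  □₀ = □̃² «a sum of 5^d cubes»; □̃₀ⁿ = □̃^{n+2}; X̃⁵(□₀) = □̃⁷ -/

/-- **p. 413 / p. 411**: *"□₀, which is a sum of 5^d cubes from 𝒟"*, *"□₀ the cube □̃²"* — the 5^d cubes of 𝒟_j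
with centres c + Mk, |k|_∞ ≤ 2 (size 2M each) fill □̃² exactly.
[cite: Balaban1985BackgroundPropagators, p.411, p.413] -/
theorem box0_eq {c : Fin d → ℝ} {M : ℝ} (hM : 0 < M) :
    (⋃ k ∈ shifts d, box (shift c M k) M) = tilde c M 2 := by
  rw [biUnion_shift_box hM le_rfl, tilde_def]; congr 1; push_cast; ring

/-- **□̃₀ⁿ = □̃^{n+2}**: the n-th tildes of the 5^d constituents of □₀ fill □̃^{n+2} (equivalently: □₀ = □̃²
widened by n big blocks on each side). [folklore] -/
theorem tilde_box0_eq {c : Fin d → ℝ} {M : ℝ} (hM : 0 < M) (n : ℕ) :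
    (⋃ k ∈ shifts d, tilde (shift c M k) M n) = tilde c M (n + 2) := by
  simp only [tilde_def]
  have hr : M ≤ ((n : ℝ) + 1) * M := le_mul_of_one_le_left hM.le (by linarith [n.cast_nonneg (α := ℝ)])
  rw [biUnion_shift_box hM hr]; congr 1; push_cast; ring

/-- p. 415 *"□̃₀² = □̃⁴"* — confirmed under the size rule of p. 408.
[cite: Balaban1985BackgroundPropagators, p.415] -/
theorem p415_tilde0_two {c : Fin d → ℝ} {M : ℝ} (hM : 0 < M) :
    (⋃ k ∈ shifts d, tilde (shift c M k) M 2) = tilde c M 4 := tilde_box0_eq hM 2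

/-- p. 415 *"boundary conditions outside □̃₀⁵ … outside □̃⁸"*: the size rule gives □̃₀⁵ = □̃⁷ (so the printed
□̃⁸ ⊇ □̃⁷ is a correct enclosure, one big block larger than the rule's value; cell note GAPS G-adv4-5 (4)).
[cite: Balaban1985BackgroundPropagators, p.415] -/
theorem p415_tilde0_five {c : Fin d → ℝ} {M : ℝ} (hM : 0 < M) :
    (⋃ k ∈ shifts d, tilde (shift c M k) M 5) = tilde c M 7 := tilde_box0_eq hM 5

/-- □̃⁷ ⊆ □̃⁸: the printed enclosure of p. 415 contains the size rule's □̃₀⁵ = □̃⁷. [folklore] -/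
theorem tilde_seven_subset_eight (c : Fin d → ℝ) {M : ℝ} (hM : 0 ≤ M) : tilde c M 7 ⊆ tilde c M 8 :=
  tilde_mono c hM (by norm_num)

/-- X̃⁵ for the localization DOMAIN X = □₀ (p. 413), read cube-by-cube: the union of the □̃′⁵ over the 5^d
constituents □′ of □₀. [cite: Balaban1985BackgroundPropagators, p.413] -/
def X5box0 (c : Fin d → ℝ) (M : ℝ) : Set (Fin d → ℝ) := ⋃ k ∈ shifts d, tilde (shift c M k) M 5

/-- **X̃⁵(□₀) = □̃⁷** (half-width 8M about the centre of □). [folklore] -/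
theorem X5box0_eq {c : Fin d → ℝ} {M : ℝ} (hM : 0 < M) : X5box0 c M = tilde c M 7 := tilde_box0_eq hM 5

/-- The U-dependence set of the domain-change factors under the cell's reading R-□₀ (Ω₀(□) ∪ Ω₀(□₀) ⊂ □̃⁵ ∪ □̃₀⁵
= □̃⁵ ∪ □̃⁷) lies in X̃⁵(□₀) — the clause of Theorems 3.9/3.10 for X = □₀, with equality of the enclosing cubes.
[folklore] -/
theorem depSet_subset_X5 {c : Fin d → ℝ} {M : ℝ} (hM : 0 < M) : tilde c M 5 ∪ tilde c M 7 ⊆ X5box0 c M := by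
  rw [X5box0_eq hM]
  exact Set.union_subset (tilde_mono c hM.le (by norm_num)) subset_rfl

/-- Coordinate extent of X̃⁵(□₀): 16M. [folklore] -/
theorem X5box0_diam {c : Fin d → ℝ} {M : ℝ} (hM : 0 < M) {x y : Fin d → ℝ} (hx : x ∈ X5box0 c M)
    (hy : y ∈ X5box0 c M) (i : Fin d) : |x i - y i| ≤ 16 * M := by
  rw [X5box0_eq hM] at hx hy
  have h := tilde_diam hx hy i
  push_cast at h
  linarith

/-! ## §4  p. 412's separation and the second case of p. 411 -/

/-- p. 412 *"the distance from □̃ to □̃₀ᶜ is at least M"* (□̃₀ = □̃³ by `tilde_box0_eq` with n = 1): every point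
within sup-distance 2M (a fortiori M) of □̃ = □̃¹ still lies in □̃³. [cite: Balaban1985BackgroundPropagators, p.412] -/
theorem dist_tilde_compl {c : Fin d → ℝ} {M : ℝ} {x y : Fin d → ℝ} (hx : x ∈ tilde c M 1)
    (hxy : ∀ i, |y i - x i| ≤ 2 * M) : y ∈ tilde c M 3 := by
  intro i
  have h := abs_sub_le (y i) (x i) (c i)
  have hx' := hx i
  push_cast at hx' ⊢
  linarith [hxy i]

/-- **Second case of p. 411** (□̃ meets a cube of 𝒟_{j+1}; □₀ = □̃₁² for the closest □₁ ∈ 𝒟_{j+1}, big blocks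
ML, centre c₁ with |c − c₁|_∞ ≤ (L+1)M): □̃⁵ ⊆ □̃₁⁷ = X̃⁵(□₀), i.e. 6M + (L+1)M ≤ 8ML, which holds iff L ≥ 1.
[folklore] -/
theorem case2_subset {c c₁ : Fin d → ℝ} {M L : ℝ} (hM : 0 ≤ M) (hL : 1 ≤ L)
    (hc : ∀ i, |c i - c₁ i| ≤ (L + 1) * M) : tilde c M 5 ⊆ tilde c₁ (M * L) 7 := by
  refine box_subset_box fun i => ?_
  have h := hc i
  push_cast
  nlinarith

/-- … and in that case □̃₁⁵ ⊆ □̃₁⁷ trivially, so the whole dependence set □̃⁵ ∪ □̃₁⁵ lies in □̃₁⁷. [folklore] -/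
theorem case2_depSet_subset {c c₁ : Fin d → ℝ} {M L : ℝ} (hM : 0 ≤ M) (hL : 1 ≤ L)
    (hc : ∀ i, |c i - c₁ i| ≤ (L + 1) * M) :
    tilde c M 5 ∪ tilde c₁ (M * L) 5 ⊆ tilde c₁ (M * L) 7 :=
  Set.union_subset (case2_subset hM hL hc) (tilde_mono c₁ (by nlinarith) (by norm_num))

/-! ## §5  The cross-read remarks R1–R3 (C-A37-1) typed -/

/-- R1, integrality: an offset which is an integer multiple of M (centres of 𝒟_j on the M-lattice, of 𝒟_{j+1} on the
ML-lattice, L ∈ ℕ) and is < (n+1)·M in absolute value is ≤ n·M. [folklore] -/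
theorem lattice_offset_le {M : ℝ} (hM : 0 < M) (m : ℤ) (n : ℕ) (h : |M * (m : ℝ)| < ((n : ℝ) + 1) * M) :
    |M * (m : ℝ)| ≤ (n : ℝ) * M := by
  rw [abs_mul, abs_of_pos hM] at h ⊢
  have h1 : |(m : ℝ)| < (n : ℝ) + 1 := by
    by_contra hcon
    have hcon := not_lt.mp hcon
    have : ((n : ℝ) + 1) * M ≤ M * |(m : ℝ)| := by nlinarith
    linarith
  have h2 : |m| < (n : ℤ) + 1 := by exact_mod_cast h1
  have h3 : |m| ≤ (n : ℤ) := by omega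
  have h4 : |(m : ℝ)| ≤ (n : ℝ) := by exact_mod_cast h3
  nlinarith

/-- R1, closed reading: with the CLOSED-intersection offset |c − c₁|_∞ ≤ (L+2)M (□₁ ∈ 𝒟_{j+1}, half-width LM, merely
TOUCHING □̃ of half-width 2M) the inclusion □̃⁵ ⊆ □̃₁⁷ of `case2_subset` still holds for L ≥ 2: 6M + (L+2)M ≤ 8LM.
[cite: Balaban1985BackgroundPropagators, p. 411 (PDF p. 23), "we take a cube □₁ from 𝒟_{j+1} which is closest to the
center of □, we replace □ by □̃₁²"] -/
theorem case2_subset_closed {c c₁ : Fin d → ℝ} {M L : ℝ} (hM : 0 ≤ M) (hL : 2 ≤ L)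
    (hc : ∀ i, |c i - c₁ i| ≤ (L + 2) * M) : tilde c M 5 ⊆ tilde c₁ (M * L) 7 := by
  refine box_subset_box fun i => ?_
  have h := hc i
  push_cast
  nlinarith

/-- R2, p. 412's distance clause in CASE 2 (□̃₀ = □̃₁³, centre c₁, big blocks ML, interior offset ≤ (L+1)M): every
point within sup-distance 2M of □̃ lies in □̃₁³ provided L ≥ 2 (5M + LM ≤ 4LM ⟸ 3L ≥ 5).  For L = 1 the clause
would fail (d = 1, M = 1, c = 0, c₁ = 2: x = −2 ∈ □̃, y = −3 ∉ [−2, 6]); L ≥ 2 throughout the series.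
[cite: Balaban1985BackgroundPropagators, p. 412 (PDF p. 24), "the distance from □̃ to □̃₀ᶜ is at least M"] -/
theorem dist_tilde_compl_case2 {c c₁ : Fin d → ℝ} {M L : ℝ} (hM : 0 ≤ M) (hL : 2 ≤ L)
    (hc : ∀ i, |c i - c₁ i| ≤ (L + 1) * M) {x y : Fin d → ℝ} (hx : x ∈ tilde c M 1)
    (hxy : ∀ i, |y i - x i| ≤ 2 * M) : y ∈ tilde c₁ (M * L) 3 := by
  intro i
  have h1 := abs_sub_le (y i) (x i) (c i)
  have h2 := abs_sub_le (y i) (c i) (c₁ i)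
  have hx' := hx i
  have hc' := hc i
  push_cast at hx' ⊢
  nlinarith [hxy i]

/-- R3, finer removed cubes: near ∂B^j(Λ_j) a cube removed by p. 411's rule may belong to 𝒟_{j−1} (half-width M/L,
centre c′ anywhere); if its box meets the INTERIOR of □̃ then it lies inside □̃² = □₀ as soon as L ≥ 2
(|z − c|_∞ ≤ M/L + M/L + 2M ≤ 3M) — so 𝒟′ remains a cover of the lattice; the count 5^d of `box0_eq` is not claimed
there. [cite: Balaban1985BackgroundPropagators, p. 411 (PDF p. 23), "removing all the cubes intersecting □̃"] -/
theorem finer_meeting_subset_box0 {c c' : Fin d → ℝ} {M L : ℝ} (hM : 0 < M) (hL : 2 ≤ L)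
    (hmeet : ∃ x ∈ box c' (M / L), ∀ i, |x i - c i| < 2 * M) : box c' (M / L) ⊆ tilde c M 2 := by
  obtain ⟨x, hx, hlt⟩ := hmeet
  have hML : M / L ≤ M / 2 := div_le_div_of_nonneg_left hM.le (by norm_num) hL
  intro z hz i
  have h1 := abs_sub_le (z i) (c' i) (c i)
  have h2 := abs_sub_le (c' i) (x i) (c i)
  have h3 : |c' i - x i| ≤ M / L := by rw [abs_sub_comm]; exact hx i
  have h4 := hz i
  have h5 := hlt i
  push_cast
  linarith

end Literature.MathematicalPhysics.QuantumFieldTheory.Balaban1983to89.B9SectCCubes
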